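import Literature.MathematicalPhysics.QuantumFieldTheory.Balaban1983to89.Beta.RemainderChartOriginDerivative
import Literature.MathematicalPhysics.QuantumFieldTheory.Balaban1983to89.Beta.RemainderDecay190TwoGrid

/-!
# [Balaban1987RG1] p. 282 ⟵ [Balaban1985Variational] Prop. 9 AT THE ORIGIN: NODE D's socket `Data190` inhabited by the
# ACTUAL derivative `(δ/δB)𝓗(0) = (1 + G̃Δ⁽²⁾)H₀` on the two-grid carrier — letters `hH0` + `hGD2H0` ONLY
# (`Beta.RemainderDecay190TwoGridOrigin`)

HONEST FRAMING (cell rule, page 1 of everything).  Discharging `BetaPertH` makes Bałaban's UV stability UNCONDITIONAL —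
a real constructive-QFT result; it is NOT the continuum limit and NOT the Clay problem.  This module discharges NOTHING of
`BetaPertH`.  It is the JUNCTION of `Beta.RemainderChartOriginDerivative` (at `B = 0` the (179) chart's derivative is
`H₀ + G̃Δ⁽²⁾H₀` for every scheme in r08's regime — (188), (189), the letters of `H` (46) and `𝔇` (73) do not enter) with the
two-grid carrier of `RemainderDecay190TwoGrid`.  For the object NODE D consumes (the derivative AT `B = 0`, [I] (4.35)) it SUPERSEDES generation 101's
`RemainderDecay190TwoGridActual.exists_data190_twoGrid_actual`, whose letter list (`hG`, `hD2H0`, `hH0`, `hH`, `h189`, `hDfr`,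
`hq`) is that of (190) on the WHOLE domain of (180).

CITATION HEADER (lean-in-tree rule 2026-08-18).  [15] = [Balaban1985Variational], Commun. Math. Phys. **102** (1985)
277–309 (held `paper:balaban1985-cmp102-variational-background`; journal page = PDF page + 276): (80) p. 290, p. 289, (179)–(180)
p. 306, (182)–(184) p. 307, (188)–(190) p. 308, Prop. 9 p. 309; [I] = [Balaban1987RG1], Commun. Math. Phys. **109** (1987), p. 282,
(4.35) p. 290, (4.4) p. 281; [B5] = [Balaban1984PropagatorsI] (1.59)–(1.63) pp. 27–28, (1.6) p. 18; [3] = [Balaban1984PropagatorsII]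
Cor. 2.8 (2.151) p. 249, (2.54) p. 233, Lemma 2.1 (2.61) p. 234.  Read by generation 103 of this unit (text layer) and by
generations 12 ∕ 101 on the renders named in `RemainderDecay190TwoGrid`.

## What is PROVED here (kernel-checked; 0 sorry; no `def`)

(K1) **`exists_data190_twoGrid_origin`** — NODE D BY THE ACTUAL DERIVATIVE AT THE ORIGIN, GENERAL BACKGROUND: per n a
Sect.-G scheme on the two-grid carrier (`𝒢 n` = G̃, `W n` = (δ/δA′)V in a `Regime` (117)–(121) with `0 < j n`, `0 < a n`,
`hWa`; `D2 n` = Δ⁽²⁾; `H₀ n`; a Sect. C map `Tm n` (47) TANGENT TO THE IDENTITY at `0` (`HasFDerivAt (Tm n) id 0`: `Y ↦ Y − HD(Y)` with D of second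
order, [15] p. 289; `RemainderChartOriginDerivative.hasFDerivAt_sectC_id`)) and TWO block letters with n-uniform constants at a rate `δ₀` — `hH0` (`H₀`, `A₀`), `hGD2H0` (`G̃Δ⁽²⁾H₀`, `A₁`); numerics
`q.δ15 ≤ 8δ₀`, `A₀ + A₁ ≤ q.Cst` + the carrier numerics.  THEN `∃ 𝒟 : Data190 D M N (fun n => XA n → ℂ) q` whose operator IS
the actual derivative, `𝒟.hn n X̄ y = (p ↦ cube(baseA n p) ∈ X̄ ? (D𝓗_n(0) δ_{σ n y})(p) : 0)` — NO (189), NO (187)–(188), NO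
letter of `H` or `𝔇`; `exists_data190_twoGrid_origin_of_letters`: the same from the located leaves `hH0`, `hG`, `hD2H0`.
(Flat background — `Δ⁽²⁾ := 0`, `H₀ := H_k`: the successor file `RemainderDecay190TwoGridOriginHk`, where the actual
derivative IS Bałaban's flat `H_k` and generation 101's hypothesis-free instance serves, letter-free.)

## What is NOT claimed

* The scheme data (`𝒢`, `W` with its `Regime`, `Tm`) are NOT Bałaban's constructed objects: the EXISTENCE of a regime for
  his `V` of (80) on this carrier and the second order of his `D` ((78)) are CARRIED (at flat background they affect only the
  well-definedness of the chart); flat: `hH0` = `RemainderDecay190TwoGridHk` hypothesis-free, `hGD2H0` void; in a background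
  field `hH0` ∕ `hGD2H0` are [B9] (3.133)∕(3.42)∕(3.137)-type letters — NE9's live `B9Eq342*` work.  Only
  the n = 0 entry of (190) is modelled on this carrier; NODE E for the general-background operator is not touched.
* No `Literature` fact is minted; no `axiom`, no `sorry`.  NOT summit progress, NOT the continuum limit, NOT Clay.
-/

namespace Literature.MathematicalPhysics.QuantumFieldTheory.Balaban1983to89.Beta.RemainderDecay190TwoGridOrigin

open Literature.MathematicalPhysics.QuantumFieldTheory.Balaban1983to89 B11SectG B6RandomWalk
open Literature.MathematicalPhysics.QuantumFieldTheory.Balaban1983to89.B9Thm34Ext (toB6)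
open Literature.MathematicalPhysics.QuantumFieldTheory.Balaban1983to89.B9Thm37GlueTorus (torusGeom tdist1)
open Literature.MathematicalPhysics.QuantumFieldTheory.Balaban1983to89.B5TorusCover (UT)
open Literature.MathematicalPhysics.QuantumFieldTheory.Balaban1983to89.TreeLengthTorus (TPt TDom)
open Literature.MathematicalPhysics.QuantumFieldTheory.Balaban1983to89.B12Decay510Window (K₁)
open Literature.MathematicalPhysics.QuantumFieldTheory.Balaban1983to89.B12Decay510Torus (tcubeOf)
open Literature.MathematicalPhysics.QuantumFieldTheory.Balaban1983to89.B11SupSize190 (supSize)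
open Literature.MathematicalPhysics.QuantumFieldTheory.Balaban1983to89.B11Eq174Chart (Regime)
open Literature.MathematicalPhysics.QuantumFieldTheory.Balaban1983to89.B11Eq183Differentiation (chartH179)
open Literature.MathematicalPhysics.QuantumFieldTheory.Balaban1983to89.Beta.RemainderDecay190 (Data190 Consts190)
open Literature.MathematicalPhysics.QuantumFieldTheory.Balaban1983to89.Beta.RemainderDecay190SectGTorus
  (hdist_torusGeom htri_torusGeom_family)
open Literature.MathematicalPhysics.QuantumFieldTheory.Balaban1983to89.Beta.RemainderRowSum (hrow_torusGeom)
open Literature.MathematicalPhysics.QuantumFieldTheory.Balaban1983to89.Beta.RemainderDecay190TwoGrid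
  (loc_supSize_single_le_one unitFieldsLocalised_supSize_single normDominated_supSize_restrict)
open Literature.MathematicalPhysics.QuantumFieldTheory.Balaban1983to89.Beta.RemainderChartOriginDerivative
  (ineq190_fderiv_chartH179_zero ineq190_fderiv_chartH179_zero_of_letters)

noncomputable section

variable {D : ℕ}

/-! ## 1. NODE D by the actual derivative at the origin, general background: two letters -/
section Origin

variable {Mc : ℕ} [NeZero Mc] {N : ℕ → ℕ} [∀ n, NeZero (N n)] {q : Consts190}

/-- **JOIN CERTIFICATE — NODE D BY THE ACTUAL DERIVATIVE `D𝓗(0) = (1 + G̃Δ⁽²⁾)H₀`, TWO LETTERS.**  Per volume index n: the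
two-grid carrier of `RemainderDecay190TwoGrid`; a Sect.-G scheme ON IT (`𝒢 n` = G̃, `W n` = (δ/δA′)V with a `Regime`, `0 < j n`,
`0 < a n`, `hWa`; `D2 n` = Δ⁽²⁾; `H₀ n`; the Sect. C map `Tm n` tangent to `id` at `0`); block letters at the
rate `δ₀` with n-UNIFORM constants for `H₀` (`hH0`, `A₀`) and for `G̃Δ⁽²⁾H₀` (`hGD2H0`, `A₁`); numerics `0 ≤ A₀ + A₁ ≤ q.Cst`,
`q.δ15 ≤ 8δ₀`, `0 < q.σ`, `c₀(δr, q.σ∕δr)^D ≤ q.cR`, `1 ≤ q.κB`, `1 ≤ q.m`, `0 ≤ q.θ`, `q.θ·M ≤ 1`.  THEN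
`∃ 𝒟 : Data190 D M N (fun n => XA n → ℂ) q` with `𝒟.hn n X̄ y = (p ↦ cube(baseA n p) ∈ X̄ ? (D𝓗_n(0) δ_{σ n y})(p) : 0)`,
`𝓗_n = chartH179 (𝒢 n) (W n) (D2 n) (H₀ n) (Tm n) (ε₄ n)`.  `h190` := `ineq190_fderiv_chartH179_zero`; NO (189).
[cite: Balaban1985Variational, (179)-(184) pp.306-307, (190) p.308, Prop. 9 p.309, (80) p.290; Balaban1987RG1, p.282, (4.35) p.290, (4.4) p.281; Balaban1984PropagatorsII, Lemma 2.1 (2.61) p.234] -/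
theorem exists_data190_twoGrid_origin (I : Type) (i₀ : I) (η L Mg R : ℕ → ℝ) (Hh : ℕ → Prop)
    (XB XA : ℕ → Type) [∀ n, Fintype (XB n)] [∀ n, Fintype (XA n)] [∀ n, DecidableEq (XB n)]
    (baseB : (n : ℕ) → XB n → TPt D (N n * Mc)) (baseA : (n : ℕ) → XA n → TPt D (N n * Mc))
    (σ : (n : ℕ) → TPt D (N n * Mc) → XB n) (hσ : ∀ n y, baseB n (σ n y) = y)
    (𝒵 : ℕ → Type) [∀ n, NormedAddCommGroup (𝒵 n)] [∀ n, NormedSpace ℂ (𝒵 n)] [∀ n, CompleteSpace (𝒵 n)]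
    (𝒢 : (n : ℕ) → 𝒵 n →L[ℂ] (XA n → ℂ)) (W : (n : ℕ) → (XA n → ℂ) → 𝒵 n)
    (D2 : (n : ℕ) → (XA n → ℂ) →L[ℂ] 𝒵 n) (H₀ : (n : ℕ) → (XB n → ℂ) →L[ℂ] (XA n → ℂ))
    (Tm : (n : ℕ) → (XA n → ℂ) → (XA n → ℂ))
    {B₀ θ C₄ a₃ j a ε₄ : ℕ → ℝ}
    (Rg : ∀ n, Regime (𝒢 n) 0 (W n) (B₀ n) (θ n) (C₄ n) (a₃ n) (j n) (a n) (ε₄ n))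
    (hWa : ∀ n, AnalyticOnNhd ℂ (W n) {Y : XA n → ℂ | ‖Y‖ < a₃ n}) (hj : ∀ n, 0 < j n) (ha : ∀ n, 0 < a n)
    (hTm : ∀ n, HasFDerivAt (Tm n) (ContinuousLinearMap.id ℂ (XA n → ℂ)) 0)
    {δ₀ A₀ A₁ δr : ℝ} (hA : 0 ≤ A₀ + A₁)
    (hH0 : ∀ n, HasMaj
      (supSize (toB6 (torusGeom (fun _ : Fin D => N n) (η n) (L n) (Mg n)) (R n) (Hh n))
        (fun y => Finset.univ.filter fun b : XB n =>
          (fun i => (⟨(tcubeOf (N n) Mc (baseB n b) i).val, ZMod.val_lt (tcubeOf (N n) Mc (baseB n b) i)⟩ :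
            Fin (N n))) = y)
        (fun b : XB n => fun i =>
          (⟨(tcubeOf (N n) Mc (baseB n b) i).val, ZMod.val_lt (tcubeOf (N n) Mc (baseB n b) i)⟩ : Fin (N n))) :
        BlockNorm (toB6 (torusGeom (fun _ : Fin D => N n) (η n) (L n) (Mg n)) (R n) (Hh n)) (XB n → ℂ))
      (supSize (toB6 (torusGeom (fun _ : Fin D => N n) (η n) (L n) (Mg n)) (R n) (Hh n))
        (fun y => Finset.univ.filter fun p : XA n =>
          (fun i => (⟨(tcubeOf (N n) Mc (baseA n p) i).val, ZMod.val_lt (tcubeOf (N n) Mc (baseA n p) i)⟩ :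
            Fin (N n))) = y)
        (fun p : XA n => fun i =>
          (⟨(tcubeOf (N n) Mc (baseA n p) i).val, ZMod.val_lt (tcubeOf (N n) Mc (baseA n p) i)⟩ : Fin (N n))) :
        BlockNorm (toB6 (torusGeom (fun _ : Fin D => N n) (η n) (L n) (Mg n)) (R n) (Hh n)) (XA n → ℂ))
      ((H₀ n).restrictScalars ℝ : (XB n → ℂ) →ₗ[ℝ] (XA n → ℂ))
      (fun y y' => A₀ * Real.exp (-(δ₀ * tdist1 (fun _ : Fin D => N n) y y'))))
    (hGD2H0 : ∀ n, HasMaj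
      (supSize (toB6 (torusGeom (fun _ : Fin D => N n) (η n) (L n) (Mg n)) (R n) (Hh n))
        (fun y => Finset.univ.filter fun b : XB n =>
          (fun i => (⟨(tcubeOf (N n) Mc (baseB n b) i).val, ZMod.val_lt (tcubeOf (N n) Mc (baseB n b) i)⟩ :
            Fin (N n))) = y)
        (fun b : XB n => fun i =>
          (⟨(tcubeOf (N n) Mc (baseB n b) i).val, ZMod.val_lt (tcubeOf (N n) Mc (baseB n b) i)⟩ : Fin (N n))) :
        BlockNorm (toB6 (torusGeom (fun _ : Fin D => N n) (η n) (L n) (Mg n)) (R n) (Hh n)) (XB n → ℂ))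
      (supSize (toB6 (torusGeom (fun _ : Fin D => N n) (η n) (L n) (Mg n)) (R n) (Hh n))
        (fun y => Finset.univ.filter fun p : XA n =>
          (fun i => (⟨(tcubeOf (N n) Mc (baseA n p) i).val, ZMod.val_lt (tcubeOf (N n) Mc (baseA n p) i)⟩ :
            Fin (N n))) = y)
        (fun p : XA n => fun i =>
          (⟨(tcubeOf (N n) Mc (baseA n p) i).val, ZMod.val_lt (tcubeOf (N n) Mc (baseA n p) i)⟩ : Fin (N n))) :
        BlockNorm (toB6 (torusGeom (fun _ : Fin D => N n) (η n) (L n) (Mg n)) (R n) (Hh n)) (XA n → ℂ))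
      ((𝒢 n ∘L (D2 n ∘L H₀ n)).restrictScalars ℝ : (XB n → ℂ) →ₗ[ℝ] (XA n → ℂ))
      (fun y y' => A₁ * Real.exp (-(δ₀ * tdist1 (fun _ : Fin D => N n) y y'))))
    (hδr : 0 < δr) (hσ₀ : 0 < q.σ) (hcR : B6.c0 δr (q.σ / δr) ^ D ≤ q.cR) (hκB : 1 ≤ q.κB)
    (hδ15 : q.δ15 ≤ 8 * δ₀) (hCst : A₀ + A₁ ≤ q.Cst) (hm1 : 1 ≤ q.m) (hθ : 0 ≤ q.θ) (hθM : q.θ * Mc ≤ 1) :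
    ∃ 𝒟 : Data190 D Mc N (fun n => XA n → ℂ) q,
      ∀ (n : ℕ) (X : TDom D (N n)) (y : TPt D (N n * Mc)),
        𝒟.hn n X y = fun p : XA n =>
          if tcubeOf (N n) Mc (baseA n p) ∈ X.1 then
            (fderiv ℂ (chartH179 (𝒢 n) (W n) (D2 n) (H₀ n) (Tm n) (ε₄ n)) 0
              (Pi.single (σ n y) (1 : ℂ))) p
          else 0 := by
  refine
    ⟨{ I := I, gn := fun n => toB6 (torusGeom (fun _ : Fin D => N n) (η n) (L n) (Mg n)) (R n) (Hh n),
       FBn := fun n => XB n → ℂ, FAn := fun n => XA n → ℂ,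
       bBn := fun n => (supSize (toB6 (torusGeom (fun _ : Fin D => N n) (η n) (L n) (Mg n)) (R n) (Hh n))
         (fun y => Finset.univ.filter fun b : XB n =>
           (fun i => (⟨(tcubeOf (N n) Mc (baseB n b) i).val, ZMod.val_lt (tcubeOf (N n) Mc (baseB n b) i)⟩ :
             Fin (N n))) = y)
         (fun b : XB n => fun i =>
           (⟨(tcubeOf (N n) Mc (baseB n b) i).val, ZMod.val_lt (tcubeOf (N n) Mc (baseB n b) i)⟩ : Fin (N n))) :
         BlockNorm (toB6 (torusGeom (fun _ : Fin D => N n) (η n) (L n) (Mg n)) (R n) (Hh n)) (XB n → ℂ)),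
       boutn := fun n _ => (supSize (toB6 (torusGeom (fun _ : Fin D => N n) (η n) (L n) (Mg n)) (R n) (Hh n))
         (fun y => Finset.univ.filter fun p : XA n =>
           (fun i => (⟨(tcubeOf (N n) Mc (baseA n p) i).val, ZMod.val_lt (tcubeOf (N n) Mc (baseA n p) i)⟩ :
             Fin (N n))) = y)
         (fun p : XA n => fun i =>
           (⟨(tcubeOf (N n) Mc (baseA n p) i).val, ZMod.val_lt (tcubeOf (N n) Mc (baseA n p) i)⟩ : Fin (N n))) :
         BlockNorm (toB6 (torusGeom (fun _ : Fin D => N n) (η n) (L n) (Mg n)) (R n) (Hh n)) (XA n → ℂ)),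
       dHn := fun n => ((fderiv ℂ (chartH179 (𝒢 n) (W n) (D2 n) (H₀ n) (Tm n) (ε₄ n)) 0).restrictScalars ℝ :
         (XB n → ℂ) →ₗ[ℝ] (XA n → ℂ)),
       blkn := fun n X => (X.1.image fun a : TPt D (N n) => fun i => (⟨(a i).val, ZMod.val_lt (a i)⟩ : Fin (N n)) :
         Finset (UT (fun _ : Fin D => N n))),
       ιn := fun n X A p => if tcubeOf (N n) Mc (baseA n p) ∈ X.1 then A p else 0,
       un := fun n y => Pi.single (σ n y) (1 : ℂ),
       h190 := fun n _ => ?_,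
       hdist := hdist_torusGeom (fun n (_ : Fin D) => N n) η L Mg R Hh,
       hrow := hrow_torusGeom (fun n (_ : Fin D) => N n) η L Mg R Hh hδr hσ₀ hcR,
       hκB := fun _ => hκB,
       hdom := fun n => normDominated_supSize_restrict (baseA n) i₀,
       hm := fun n y y' => (loc_supSize_single_le_one
         (g := toB6 (torusGeom (fun _ : Fin D => N n) (η n) (L n) (Mg n)) (R n) (Hh n)) (σ n y) y').trans hm1,
       hD := fun n => unitFieldsLocalised_supSize_single (baseB n) (σ n) (hσ n) hθ hθM },
      fun _ _ _ => rfl⟩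
  -- (190) at the origin, constant A₀ + A₁ ≤ q.Cst, rate q.δ15/8 ≤ δ₀
  have h190 := ineq190_fderiv_chartH179_zero (Rg n) (hWa n) (hj n) (ha n) (hTm n)
    (hdist_torusGeom (fun n (_ : Fin D) => N n) η L Mg R Hh n) hA (by linarith : q.δ15 / 8 ≤ δ₀) (hH0 n) (hGD2H0 n)
  refine h190.mono fun y y' => ?_
  exact mul_le_mul_of_nonneg_right hCst (Real.exp_pos _).le

/-- **THE SAME FROM THE THREE LOCATED LEAVES** `hH0` (H₀, constant `A₀`), `hG` (G̃ between an auxiliary size `b3 n` on `𝒵 n`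
and the configuration size, constant `B_G`), `hD2H0` (Δ⁽²⁾H₀, constant `c_Δ`), all at the rate `δ₀ > 0`, composed on the site
tori through (2.54) and the row sum (2.61) at the rate `s₁ ∈ (0, δ₀)` with constant `c₁ ≥ c₀(δ₀, s₁∕δ₀)^D`: constant
`A₀ + κ₃·B_G·c_Δ·c₁ ≤ q.Cst` (every n), rate `q.δ15 ≤ 8(δ₀ − s₁)`.
[cite: Balaban1985Variational, (182)-(184) p.307, (190) p.308; Balaban1984PropagatorsII, (2.54) p.233, Lemma 2.1 (2.61) p.234; Balaban1987RG1, p.282] -/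
theorem exists_data190_twoGrid_origin_of_letters (I : Type) (i₀ : I) (η L Mg R : ℕ → ℝ) (Hh : ℕ → Prop)
    (XB XA : ℕ → Type) [∀ n, Fintype (XB n)] [∀ n, Fintype (XA n)] [∀ n, DecidableEq (XB n)]
    (baseB : (n : ℕ) → XB n → TPt D (N n * Mc)) (baseA : (n : ℕ) → XA n → TPt D (N n * Mc))
    (σ : (n : ℕ) → TPt D (N n * Mc) → XB n) (hσ : ∀ n y, baseB n (σ n y) = y)
    (𝒵 : ℕ → Type) [∀ n, NormedAddCommGroup (𝒵 n)] [∀ n, NormedSpace ℂ (𝒵 n)] [∀ n, CompleteSpace (𝒵 n)]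
    (𝒢 : (n : ℕ) → 𝒵 n →L[ℂ] (XA n → ℂ)) (W : (n : ℕ) → (XA n → ℂ) → 𝒵 n)
    (D2 : (n : ℕ) → (XA n → ℂ) →L[ℂ] 𝒵 n) (H₀ : (n : ℕ) → (XB n → ℂ) →L[ℂ] (XA n → ℂ))
    (Tm : (n : ℕ) → (XA n → ℂ) → (XA n → ℂ))
    {B₀ θ C₄ a₃ j a ε₄ : ℕ → ℝ}
    (Rg : ∀ n, Regime (𝒢 n) 0 (W n) (B₀ n) (θ n) (C₄ n) (a₃ n) (j n) (a n) (ε₄ n))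
    (hWa : ∀ n, AnalyticOnNhd ℂ (W n) {Y : XA n → ℂ | ‖Y‖ < a₃ n}) (hj : ∀ n, 0 < j n) (ha : ∀ n, 0 < a n)
    (hTm : ∀ n, HasFDerivAt (Tm n) (ContinuousLinearMap.id ℂ (XA n → ℂ)) 0)
    (b3 : (n : ℕ) → BlockNorm (toB6 (torusGeom (fun _ : Fin D => N n) (η n) (L n) (Mg n)) (R n) (Hh n)) (𝒵 n))
    {δ₀ A₀ BG cΔ s₁ c₁ δr : ℝ} (hδ₀ : 0 < δ₀) (hA₀ : 0 ≤ A₀) (hBG : 0 ≤ BG) (hcΔ : 0 ≤ cΔ)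
    (hs₁ : 0 < s₁) (hs₁δ₀ : s₁ < δ₀) (hc₁ : B6.c0 δ₀ (s₁ / δ₀) ^ D ≤ c₁)
    (hH0 : ∀ n, HasMaj
      (supSize (toB6 (torusGeom (fun _ : Fin D => N n) (η n) (L n) (Mg n)) (R n) (Hh n))
        (fun y => Finset.univ.filter fun b : XB n =>
          (fun i => (⟨(tcubeOf (N n) Mc (baseB n b) i).val, ZMod.val_lt (tcubeOf (N n) Mc (baseB n b) i)⟩ :
            Fin (N n))) = y)
        (fun b : XB n => fun i =>
          (⟨(tcubeOf (N n) Mc (baseB n b) i).val, ZMod.val_lt (tcubeOf (N n) Mc (baseB n b) i)⟩ : Fin (N n))) :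
        BlockNorm (toB6 (torusGeom (fun _ : Fin D => N n) (η n) (L n) (Mg n)) (R n) (Hh n)) (XB n → ℂ))
      (supSize (toB6 (torusGeom (fun _ : Fin D => N n) (η n) (L n) (Mg n)) (R n) (Hh n))
        (fun y => Finset.univ.filter fun p : XA n =>
          (fun i => (⟨(tcubeOf (N n) Mc (baseA n p) i).val, ZMod.val_lt (tcubeOf (N n) Mc (baseA n p) i)⟩ :
            Fin (N n))) = y)
        (fun p : XA n => fun i =>
          (⟨(tcubeOf (N n) Mc (baseA n p) i).val, ZMod.val_lt (tcubeOf (N n) Mc (baseA n p) i)⟩ : Fin (N n))) :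
        BlockNorm (toB6 (torusGeom (fun _ : Fin D => N n) (η n) (L n) (Mg n)) (R n) (Hh n)) (XA n → ℂ))
      ((H₀ n).restrictScalars ℝ : (XB n → ℂ) →ₗ[ℝ] (XA n → ℂ))
      (fun y y' => A₀ * Real.exp (-(δ₀ * tdist1 (fun _ : Fin D => N n) y y'))))
    (hG : ∀ n, HasMaj (b3 n)
      (supSize (toB6 (torusGeom (fun _ : Fin D => N n) (η n) (L n) (Mg n)) (R n) (Hh n))
        (fun y => Finset.univ.filter fun p : XA n =>
          (fun i => (⟨(tcubeOf (N n) Mc (baseA n p) i).val, ZMod.val_lt (tcubeOf (N n) Mc (baseA n p) i)⟩ :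
            Fin (N n))) = y)
        (fun p : XA n => fun i =>
          (⟨(tcubeOf (N n) Mc (baseA n p) i).val, ZMod.val_lt (tcubeOf (N n) Mc (baseA n p) i)⟩ : Fin (N n))) :
        BlockNorm (toB6 (torusGeom (fun _ : Fin D => N n) (η n) (L n) (Mg n)) (R n) (Hh n)) (XA n → ℂ))
      ((𝒢 n).restrictScalars ℝ : 𝒵 n →ₗ[ℝ] (XA n → ℂ))
      (fun y y' => BG * Real.exp (-(δ₀ * tdist1 (fun _ : Fin D => N n) y y'))))
    (hD2H0 : ∀ n, HasMaj
      (supSize (toB6 (torusGeom (fun _ : Fin D => N n) (η n) (L n) (Mg n)) (R n) (Hh n))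
        (fun y => Finset.univ.filter fun b : XB n =>
          (fun i => (⟨(tcubeOf (N n) Mc (baseB n b) i).val, ZMod.val_lt (tcubeOf (N n) Mc (baseB n b) i)⟩ :
            Fin (N n))) = y)
        (fun b : XB n => fun i =>
          (⟨(tcubeOf (N n) Mc (baseB n b) i).val, ZMod.val_lt (tcubeOf (N n) Mc (baseB n b) i)⟩ : Fin (N n))) :
        BlockNorm (toB6 (torusGeom (fun _ : Fin D => N n) (η n) (L n) (Mg n)) (R n) (Hh n)) (XB n → ℂ))
      (b3 n) ((D2 n ∘L H₀ n).restrictScalars ℝ : (XB n → ℂ) →ₗ[ℝ] 𝒵 n)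
      (fun y y' => cΔ * Real.exp (-(δ₀ * tdist1 (fun _ : Fin D => N n) y y'))))
    (hδr : 0 < δr) (hσ₀ : 0 < q.σ) (hcR : B6.c0 δr (q.σ / δr) ^ D ≤ q.cR) (hκB : 1 ≤ q.κB)
    (hδ15 : q.δ15 ≤ 8 * (δ₀ - s₁)) (hCst : ∀ n, A₀ + (b3 n).κ * BG * cΔ * c₁ ≤ q.Cst) (hm1 : 1 ≤ q.m)
    (hθ : 0 ≤ q.θ) (hθM : q.θ * Mc ≤ 1) :
    ∃ 𝒟 : Data190 D Mc N (fun n => XA n → ℂ) q,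
      ∀ (n : ℕ) (X : TDom D (N n)) (y : TPt D (N n * Mc)),
        𝒟.hn n X y = fun p : XA n =>
          if tcubeOf (N n) Mc (baseA n p) ∈ X.1 then
            (fderiv ℂ (chartH179 (𝒢 n) (W n) (D2 n) (H₀ n) (Tm n) (ε₄ n)) 0
              (Pi.single (σ n y) (1 : ℂ))) p
          else 0 := by
  -- the row sum (2.61) at the rate s₁ on the site tori, one constant c₁ for all n
  have hrow₁ : ∀ n, RowSum (toB6 (torusGeom (fun _ : Fin D => N n) (η n) (L n) (Mg n)) (R n) (Hh n)) s₁ c₁ :=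
    hrow_torusGeom (fun n (_ : Fin D) => N n) η L Mg R Hh hδ₀ hs₁ hc₁
  have hc₁nn : 0 ≤ c₁ :=
    le_trans (pow_nonneg (by unfold B6.c0; exact tsum_nonneg fun z => (Real.exp_pos _).le) _) hc₁
  refine
    ⟨{ I := I, gn := fun n => toB6 (torusGeom (fun _ : Fin D => N n) (η n) (L n) (Mg n)) (R n) (Hh n),
       FBn := fun n => XB n → ℂ, FAn := fun n => XA n → ℂ,
       bBn := fun n => (supSize (toB6 (torusGeom (fun _ : Fin D => N n) (η n) (L n) (Mg n)) (R n) (Hh n))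
         (fun y => Finset.univ.filter fun b : XB n =>
           (fun i => (⟨(tcubeOf (N n) Mc (baseB n b) i).val, ZMod.val_lt (tcubeOf (N n) Mc (baseB n b) i)⟩ :
             Fin (N n))) = y)
         (fun b : XB n => fun i =>
           (⟨(tcubeOf (N n) Mc (baseB n b) i).val, ZMod.val_lt (tcubeOf (N n) Mc (baseB n b) i)⟩ : Fin (N n))) :
         BlockNorm (toB6 (torusGeom (fun _ : Fin D => N n) (η n) (L n) (Mg n)) (R n) (Hh n)) (XB n → ℂ)),
       boutn := fun n _ => (supSize (toB6 (torusGeom (fun _ : Fin D => N n) (η n) (L n) (Mg n)) (R n) (Hh n))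
         (fun y => Finset.univ.filter fun p : XA n =>
           (fun i => (⟨(tcubeOf (N n) Mc (baseA n p) i).val, ZMod.val_lt (tcubeOf (N n) Mc (baseA n p) i)⟩ :
             Fin (N n))) = y)
         (fun p : XA n => fun i =>
           (⟨(tcubeOf (N n) Mc (baseA n p) i).val, ZMod.val_lt (tcubeOf (N n) Mc (baseA n p) i)⟩ : Fin (N n))) :
         BlockNorm (toB6 (torusGeom (fun _ : Fin D => N n) (η n) (L n) (Mg n)) (R n) (Hh n)) (XA n → ℂ)),
       dHn := fun n => ((fderiv ℂ (chartH179 (𝒢 n) (W n) (D2 n) (H₀ n) (Tm n) (ε₄ n)) 0).restrictScalars ℝ :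
         (XB n → ℂ) →ₗ[ℝ] (XA n → ℂ)),
       blkn := fun n X => (X.1.image fun a : TPt D (N n) => fun i => (⟨(a i).val, ZMod.val_lt (a i)⟩ : Fin (N n)) :
         Finset (UT (fun _ : Fin D => N n))),
       ιn := fun n X A p => if tcubeOf (N n) Mc (baseA n p) ∈ X.1 then A p else 0,
       un := fun n y => Pi.single (σ n y) (1 : ℂ),
       h190 := fun n _ => ?_,
       hdist := hdist_torusGeom (fun n (_ : Fin D) => N n) η L Mg R Hh,
       hrow := hrow_torusGeom (fun n (_ : Fin D) => N n) η L Mg R Hh hδr hσ₀ hcR,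
       hκB := fun _ => hκB,
       hdom := fun n => normDominated_supSize_restrict (baseA n) i₀,
       hm := fun n y y' => (loc_supSize_single_le_one
         (g := toB6 (torusGeom (fun _ : Fin D => N n) (η n) (L n) (Mg n)) (R n) (Hh n)) (σ n y) y').trans hm1,
       hD := fun n => unitFieldsLocalised_supSize_single (baseB n) (σ n) (hσ n) hθ hθM },
      fun _ _ _ => rfl⟩
  have h190 := ineq190_fderiv_chartH179_zero_of_letters (Rg n) (hWa n) (hj n) (ha n) (hTm n)
    (htri_torusGeom_family (fun n (_ : Fin D) => N n) η L Mg R Hh n)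
    (hdist_torusGeom (fun n (_ : Fin D) => N n) η L Mg R Hh n) (hrow₁ n) hc₁nn hA₀ hBG hcΔ hs₁.le
    (by linarith : 0 ≤ δ₀ - s₁) (by linarith : δ₀ - s₁ + s₁ ≤ δ₀) (by linarith : q.δ15 / 8 ≤ δ₀ - s₁)
    (hH0 n) (hG n) (hD2H0 n)
  refine h190.mono fun y y' => ?_
  exact mul_le_mul_of_nonneg_right (hCst n) (Real.exp_pos _).le
end Origin


end

end Literature.MathematicalPhysics.QuantumFieldTheory.Balaban1983to89.Beta.RemainderDecay190TwoGridOrigin
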